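import Mathlib
import HarnessLib
import Summits.NavierStokesRegularity.FluidComputer.PalasekTowerEpisodesPinned
import Summits.NavierStokesRegularity.FluidComputer.PalasekTowerExponentLedger

/-!
# The FC-AUDIT floor in the tower's units: the efficiency the `fc-oneshot` transfer stub asks for is
# `η_k = N_k^{(b-1)(2β-5)} < 1`, and `η_k λ_k = (Re_{k+1}/Re_k)² = N_k^{2(b-1)(β-2)} > 1` at every level

Cell `ns-blowup`, seat `ns-blowup-fc-prover-1` (D-0074 GROUP C «bridge support»); companion of
`GadgetLedger.lean` (the uniform-ratio ledger) written for the crux item `EpisodeInduction`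
(stmt-NavierStokesRegularity-19178) of route `PalasekTowerBreakdown`, line `fc-oneshot`
(ns-blowup-fc-route g0, `Cruxes/EpisodeInduction/Lines/fc-oneshot.lean`, card `Lines/fc-oneshot.md`);
it proves none of the line's registered stubs and is therefore a dictionary file here, attached to the
item as evidence, not a `--supports` helper. LABEL: E–C bookkeeping. WHAT THIS IS NOT: not Navier–Stokes — identities and
inequalities between the REAL EXPONENTS of a rates record `TowerRates` (`N_k = N₀^{b^k}`, `A_k = N_k^β`,
`Y_k = N_k^{β-1}`); no stage, flow or blow-up is asserted, and nothing here touches the stubs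
`stub_envelope` / `stub_transfer` / `stub_replication` themselves — it kernel-checks the ARITHMETIC the
card quotes for the load-bearing stub `stub_transfer` ("CHECK the exponent").

The card's reading of `stub_transfer` (the FC lever in tower units): a level-`k` structure of velocity
`Y_k` at scale `1/N_k` carries energy `≍ Y_k² N_k^{-3}`; the stub asks a cell of radius `1/N_{k+1}` with
energy `≥ (2c₁Y_{k+1})² · vol`, i.e. `≍ Y_{k+1}² N_{k+1}^{-3}`; so the NEEDED ONE-CHILD EFFICIENCY is
`η_k := (Y_{k+1}/Y_k)² (N_k/N_{k+1})³` at scale ratio `λ_k := N_{k+1}/N_k = N_k^{b-1}`. This file proves,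
for EVERY admissible rates record `R : TowerRates` and every level `k`:

* `towerFc_levelRe_eq` — the level Reynolds number of the dictionary, `Re_k := Y_k/N_k = N_k^{β-2}`
  (`= N_k^{0.3}` on the wide rates, `towerFc_wide_exponents`), and `towerFc_levelRe_succ` —
  `Re_{k+1} = N_k^{(b-1)(β-2)} · Re_k`, strictly increasing (`towerFc_levelRe_lt_succ`);
* `towerFc_efficiency_eq` — `η_k = N_k^{(b-1)(2β-5)}`; `towerFc_efficiency_lt_one` — `η_k < 1` (the stub
  never asks for more than the whole level energy: `β < α ≤ 5/2`), `towerFc_efficiency_pos`;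
* `towerFc_efficiency_mul_ratio_eq_levelRe_sq` — THE LEDGER IDENTITY `η_k λ_k = (Re_{k+1}/Re_k)²`
  (one child: `Re' = (ηλ)^{1/2} Re`, the FC-AUDIT bookkeeping of KILLSHEET §VI.3, cf. the uniform-ratio
  ledger `Summits/NavierStokesRegularity/FluidComputer/GadgetLedger.lean`, `packetReynolds_succ`, and
  `PalasekTowerExponentLedger.reynolds_grows_iff`);
* `towerFc_efficiency_mul_ratio_eq` — `η_k λ_k = N_k^{2(b-1)(β-2)}` and `towerFc_one_lt_efficiency_mul_ratio`
  — THE FC-AUDIT FLOOR `η_k λ_k > 1` HOLDS AT EVERY LEVEL OF EVERY ADMISSIBLE TOWER (`b > 1`, `β > 2`),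
  also spelled `1/λ_k < η_k` through `PalasekTowerExponentLedger.reynolds_grows_iff`
  (`towerFc_inv_ratio_lt_efficiency`), with the card's numbers on the wide rates: `(b-1)(2β-5) = -1/25` and `2(b-1)(β-2) = 3/50`
  (`towerFc_wide_exponents`: `η_k = N_k^{-0.04}`, `η_k λ_k = N_k^{0.06}`).

So the floor side of the FC lever is free in the registered rates; what `stub_transfer` bets on is that the
unforced level-`k` structure DELIVERS the fraction `η_k` into one child cell inside the rigid window —
the physics, untouched here. Sources: S. Palasek, arXiv:2605.13827 §1.2/§3 (rates) via the tree's
`TowerRates`; the cell's KILLSHEET §VI.3 (FC-AUDIT). 0 sorry; axioms ⊆ {propext, Classical.choice,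
Quot.sound}.
-/

noncomputable section

namespace Summit.NavierStokesRegularity.FluidComputer.GadgetLedger

open Summit.NavierStokesRegularity.FluidComputer.PalasekTowerClayBridge

variable (R : TowerRates)

/-- The velocity scales are positive. -/
theorem towerFc_Y_pos (k : ℕ) : 0 < R.Y k := Real.rpow_pos_of_pos (R.N_pos k) _

/-- The dictionary's level Reynolds number `Re_k = Y_k / N_k` is `N_k^{β-2}`. -/
theorem towerFc_levelRe_eq (k : ℕ) : R.Y k / R.N k = R.N k ^ (R.β - 2) := by
  unfold TowerRates.Y
  rw [show R.β - 2 = (R.β - 1) - 1 by ring, Real.rpow_sub_one (R.N_pos k).ne' (R.β - 1)]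

/-- The level Reynolds numbers are positive. -/
theorem towerFc_levelRe_pos (k : ℕ) : 0 < R.Y k / R.N k := div_pos (towerFc_Y_pos R k) (R.N_pos k)

/-- `Re_{k+1} = N_k^{(b-1)(β-2)} · Re_k`. -/
theorem towerFc_levelRe_succ (k : ℕ) :
    R.Y (k + 1) / R.N (k + 1) = R.N k ^ ((R.b - 1) * (R.β - 2)) * (R.Y k / R.N k) := by
  rw [towerFc_levelRe_eq, towerFc_levelRe_eq, R.N_succ k, ← Real.rpow_mul (R.N_pos k).le,
    ← Real.rpow_add (R.N_pos k)]
  congr 1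
  ring

/-- The level Reynolds numbers climb strictly: `Re_k < Re_{k+1}` (`b > 1`, `β > 2`, `N_k > 1`). -/
theorem towerFc_levelRe_lt_succ (k : ℕ) : R.Y k / R.N k < R.Y (k + 1) / R.N (k + 1) := by
  rw [towerFc_levelRe_succ]
  have hexp : 0 < (R.b - 1) * (R.β - 2) :=
    mul_pos (by linarith [R.one_lt_b]) (by linarith [R.two_lt_β])
  exact lt_mul_left (towerFc_levelRe_pos R k) (Real.one_lt_rpow (R.one_lt_N k) hexp)

/-- The scale ratio of one level is `λ_k = N_{k+1}/N_k = N_k^{b-1}`. -/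
theorem towerFc_ratio_eq (k : ℕ) : R.N (k + 1) / R.N k = R.N k ^ (R.b - 1) := by
  rw [R.N_succ k, Real.rpow_sub_one (R.N_pos k).ne']

/-- The needed one-child efficiency of the `fc-oneshot` transfer stub,
`η_k = (Y_{k+1}/Y_k)² (N_k/N_{k+1})³`, is `N_k^{(b-1)(2β-5)}`. -/
theorem towerFc_efficiency_eq (k : ℕ) :
    (R.Y (k + 1) / R.Y k) ^ 2 * (R.N k / R.N (k + 1)) ^ 3 = R.N k ^ ((R.b - 1) * (2 * R.β - 5)) := by
  have hN := R.N_pos k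
  have hY : R.Y (k + 1) / R.Y k = R.N k ^ ((R.b - 1) * (R.β - 1)) := by
    rw [R.Y_succ k, mul_div_assoc, div_self (towerFc_Y_pos R k).ne', mul_one]
  have hNr : R.N k / R.N (k + 1) = R.N k ^ (1 - R.b) := by
    rw [R.N_succ k, Real.rpow_sub hN, Real.rpow_one]
  rw [hY, hNr, ← Real.rpow_natCast (R.N k ^ _) 2, ← Real.rpow_natCast (R.N k ^ _) 3,
    ← Real.rpow_mul hN.le, ← Real.rpow_mul hN.le, ← Real.rpow_add hN]
  congr 1
  push_cast
  ring

/-- The needed efficiency is positive. -/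
theorem towerFc_efficiency_pos (k : ℕ) :
    0 < (R.Y (k + 1) / R.Y k) ^ 2 * (R.N k / R.N (k + 1)) ^ 3 := by
  rw [towerFc_efficiency_eq]
  exact Real.rpow_pos_of_pos (R.N_pos k) _

/-- The needed efficiency is BELOW ONE at every level (it never asks for more than the whole level
energy): the exponent `(b-1)(2β-5)` is negative because `β < α ≤ 5/2`. -/
theorem towerFc_efficiency_lt_one (k : ℕ) :
    (R.Y (k + 1) / R.Y k) ^ 2 * (R.N k / R.N (k + 1)) ^ 3 < 1 := by
  rw [towerFc_efficiency_eq]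
  have hexp : (R.b - 1) * (2 * R.β - 5) < 0 :=
    mul_neg_of_pos_of_neg (by linarith [R.one_lt_b]) (by linarith [R.β_lt_α, R.α_le])
  exact Real.rpow_lt_one_of_one_lt_of_neg (R.one_lt_N k) hexp

/-- THE LEDGER IDENTITY (one child, `Re' = (ηλ)^{1/2} Re`): `η_k · λ_k = (Re_{k+1}/Re_k)²` — pure
algebra of the dictionary `E ≍ Y² N⁻³`, `Re = Y/N`. -/
theorem towerFc_efficiency_mul_ratio_eq_levelRe_sq (k : ℕ) :
    (R.Y (k + 1) / R.Y k) ^ 2 * (R.N k / R.N (k + 1)) ^ 3 * (R.N (k + 1) / R.N k) =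
      ((R.Y (k + 1) / R.N (k + 1)) / (R.Y k / R.N k)) ^ 2 := by
  have hN := (R.N_pos k).ne'
  have hN' := (R.N_pos (k + 1)).ne'
  have hY := (towerFc_Y_pos R k).ne'
  field_simp

/-- `η_k · λ_k = N_k^{2(b-1)(β-2)}`. -/
theorem towerFc_efficiency_mul_ratio_eq (k : ℕ) :
    (R.Y (k + 1) / R.Y k) ^ 2 * (R.N k / R.N (k + 1)) ^ 3 * (R.N (k + 1) / R.N k) =
      R.N k ^ (2 * (R.b - 1) * (R.β - 2)) := by
  rw [towerFc_efficiency_eq, towerFc_ratio_eq, ← Real.rpow_add (R.N_pos k)]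
  congr 1
  ring

/-- **THE FC-AUDIT FLOOR HOLDS IN THE TOWER'S UNITS AT EVERY LEVEL**: `1 < η_k · λ_k` for every
admissible rates record and every `k` (`b > 1`, `β > 2`, `N_k > 1`) — «η_k λ_k ≥ 1 uniformly in k»
with room; equivalently (`towerFc_efficiency_mul_ratio_eq_levelRe_sq`) the level Reynolds numbers climb. -/
theorem towerFc_one_lt_efficiency_mul_ratio (k : ℕ) :
    1 < (R.Y (k + 1) / R.Y k) ^ 2 * (R.N k / R.N (k + 1)) ^ 3 * (R.N (k + 1) / R.N k) := by
  rw [towerFc_efficiency_mul_ratio_eq]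
  have hexp : 0 < 2 * (R.b - 1) * (R.β - 2) := by
    have := mul_pos (by linarith [R.one_lt_b] : (0:ℝ) < R.b - 1) (by linarith [R.two_lt_β] : (0:ℝ) < R.β - 2)
    linarith
  exact Real.one_lt_rpow (R.one_lt_N k) hexp

/-- The floor in the spelling of `PalasekTowerExponentLedger.reynolds_grows_iff`
(`1 < ηλ ↔ 1/λ < η`, the instab seat's exponent ledger, §4): `1/λ_k < η_k` at every level. -/
theorem towerFc_inv_ratio_lt_efficiency (k : ℕ) :
    1 / (R.N (k + 1) / R.N k) < (R.Y (k + 1) / R.Y k) ^ 2 * (R.N k / R.N (k + 1)) ^ 3 :=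
  (PalasekTowerExponentLedger.reynolds_grows_iff (div_pos (R.N_pos (k + 1)) (R.N_pos k))).1
    (towerFc_one_lt_efficiency_mul_ratio R k)

/-- The card's numbers on the WIDE rates `(N₀, b, β, α) = (256, 11/10, 23/10, 49/20)`: Reynolds
exponent `β - 2 = 3/10`, efficiency exponent `(b-1)(2β-5) = -1/25` (`η_k = N_k^{-0.04}`), floor
exponent `2(b-1)(β-2) = 3/50` (`η_k λ_k = N_k^{0.06}`), per-level Reynolds gain exponent
`(b-1)(β-2) = 3/100`. -/
theorem towerFc_wide_exponents :
    TowerRates.wide.β - 2 = 3 / 10 ∧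
      (TowerRates.wide.b - 1) * (2 * TowerRates.wide.β - 5) = -(1 / 25) ∧
        2 * (TowerRates.wide.b - 1) * (TowerRates.wide.β - 2) = 3 / 50 ∧
          (TowerRates.wide.b - 1) * (TowerRates.wide.β - 2) = 3 / 100 := by
  refine ⟨?_, ?_, ?_, ?_⟩ <;> norm_num [TowerRates.wide]

/-- On the wide rates the needed efficiency is `η_k = N_k^{-1/25}` and the floor product is
`η_k λ_k = N_k^{3/50}`. -/
theorem towerFc_wide_efficiency (k : ℕ) :
    (TowerRates.wide.Y (k + 1) / TowerRates.wide.Y k) ^ 2 *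
        (TowerRates.wide.N k / TowerRates.wide.N (k + 1)) ^ 3 = TowerRates.wide.N k ^ (-(1 / 25 : ℝ)) ∧
      (TowerRates.wide.Y (k + 1) / TowerRates.wide.Y k) ^ 2 *
          (TowerRates.wide.N k / TowerRates.wide.N (k + 1)) ^ 3 *
          (TowerRates.wide.N (k + 1) / TowerRates.wide.N k) = TowerRates.wide.N k ^ (3 / 50 : ℝ) := by
  obtain ⟨_, h2, h3, _⟩ := towerFc_wide_exponents
  exact ⟨by rw [towerFc_efficiency_eq, h2], by rw [towerFc_efficiency_mul_ratio_eq, h3]⟩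

end Summit.NavierStokesRegularity.FluidComputer.GadgetLedger

end
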